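import Literature.Analysis.ODE.RecessiveDominance
import Literature.Analysis.ODE.GrowthChain
import HarnessLib

/-!
# Recessive dominance with the depth certified on an interior sub-barrier

Topic `Literature/Analysis/ODE` (namespace `Literature.Analysis.ODE`). Continuation of
`RecessiveDominance.lean`: the real equation `y″ = q(x) y` on a forbidden interval `[α, β]` (`q ≥ 0`),
its right-recessive real solution `d` (`d(β) = 1`, `d′(β) = 0`, convex, non-increasing), and a
COMPLEX solution `v` known through its data at the right end `β` (`‖v′(β)‖ ≤ P₁`, conserved flux
`Im(v̄ v′) ≡ F ≠ 0`). `RecessiveDominance.re_conj_mul_deriv_le_of_right_flux` needs the DEPTH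
`4P₁² ≤ |F|·d(α)·(−d′(α))` and a RATE `r d(α) ≤ −d′(α)`; its packaged form
`re_conj_mul_deriv_le_of_right_flux_of_sq_le` assumes ONE floor `q ≥ k²` on the whole of `[α, β]`.
When the coefficient varies by orders of magnitude along the barrier (Carter's equation of the
near-extremal Kerr programme: `q ≍ κ²` at the collar, `q ≍ 1` on the far part of the barrier,
`q → 0` at the turning point) the depth is best certified on an interior stretch `[s₀, s₁] ⊆ [α, β]`
where `q ≥ k²` with `k(s₁ − s₀)` large, and the rate separately with the (small) global floor
`q ≥ k₀²` on `[α, β]`: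

* `div_one_add_le_tanh` — `z/(1 + z) ≤ tanh z` for `z ≥ 0` (the rate `k₀ tanh(k₀ℓ)` is at least
  `k₀²ℓ/(1 + k₀ℓ)`, polynomial in `k₀⁻¹`, `ℓ⁻¹`);
* `cosh_mul_le_and_sinh_mul_le_of_subBarrier` — for `d″ = q d` on `[α, β]` with `q ≥ 0`, `d ≥ 0`,
  `d′(β) ≤ 0`, and `q ≥ k²` on `[s₀, s₁] ⊆ [α, β]` (`k > 0`):
  `d(s₁)·cosh(k(s₁ − s₀)) ≤ d(α)` and `d(s₁)·k·sinh(k(s₁ − s₀)) ≤ −d′(α)`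
  (cosh growth and the Riccati rate on the stretch, then monotonicity of `d` and of `d′` down to `α`);
* `re_conj_mul_deriv_le_of_right_flux_subBarrier` — the packaged dominance statement: `q` continuous,
  `q ≥ k₀²` on `[α, β]`, `q ≥ k²` on `[s₀, s₁] ⊆ [α, β]` (`s₀ < s₁`), `8P₁² ≤ k|F|·sinh(2k(s₁ − s₀))`
  give `Re(v̄(α) v′(α)) ≤ −(7/25)·k₀ tanh(k₀(β − α))·|v(α)|²`;
* `kernel_le_of_recessive_dominated_quasi` — with a quasi-monotone outward-growing partner `u`
  (`|u(x)| ≤ A|u(α)|`, `Re(ū u′)(α) ≥ 0`) and `Re(v̄ v′)(α) ≤ −r|v(α)|²`: `r·|u(x)||v(α)| ≤ A·|W(α)|`;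
* `sq_mul_div_one_add_le_mul_tanh` — the rate floor `k₀²ℓ₀/(1 + k₀ℓ₀) ≤ k₀ tanh(k₀ℓ)` for `ℓ₀ ≤ ℓ`.

Everything is one-interval real analysis on top of the landed bricks; all proved.

## References
* P. Hartman, *Ordinary Differential Equations* (SIAM Classics 38, 2002), Ch. XI §§2, 3, 6
  (Riccati/Sturm comparison, principal solutions). Key `Hartman2002`.
* I. M. Gelfand, L. A. Dikii, Russian Math. Surveys 30:5 (1975) (diagonal resolvent kernel `ψ₊ψ₋/W`).
-/

noncomputable section

open Set
open scoped ComplexConjugate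

namespace Literature.Analysis.ODE

/-! ### An elementary lower bound for `tanh` -/

/-- `z/(1 + z) ≤ tanh z` for `z ≥ 0` (equivalent to `1 + 2z ≤ e^{2z}`). [folklore] -/
theorem div_one_add_le_tanh {z : ℝ} (hz : 0 ≤ z) : z / (1 + z) ≤ Real.tanh z := by
  rw [Real.tanh_eq_sinh_div_cosh, Real.sinh_eq, Real.cosh_eq]
  have h1 : 0 < Real.exp z := Real.exp_pos z
  have h2 : 0 < Real.exp (-z) := Real.exp_pos _
  have h3 : Real.exp z * Real.exp (-z) = 1 := by
    rw [← Real.exp_add, add_neg_cancel, Real.exp_zero]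
  -- `1 + 2z ≤ e^{2z} = (e^z)²`
  have h4 : 1 + 2 * z ≤ Real.exp z * Real.exp z := by
    rw [← Real.exp_add]
    have := Real.add_one_le_exp (z + z)
    linarith
  rw [div_le_div_iff₀ (by positivity) (by positivity)]
  -- `z (e^z + e^{-z}) ≤ (1 + z)(e^z − e^{-z})` iff `(1 + 2z) e^{-z} ≤ e^z`
  nlinarith [mul_le_mul_of_nonneg_right h4 h2.le, h3]

/-- `tanh` is monotone (`tanh y − tanh x = sinh(y − x)/(cosh x cosh y)`). [folklore] -/
private theorem tanh_le_tanh' {x y : ℝ} (h : x ≤ y) : Real.tanh x ≤ Real.tanh y := by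
  rw [Real.tanh_eq_sinh_div_cosh, Real.tanh_eq_sinh_div_cosh,
    div_le_div_iff₀ (Real.cosh_pos x) (Real.cosh_pos y)]
  have : 0 ≤ Real.sinh (y - x) := Real.sinh_nonneg_iff.2 (sub_nonneg.2 h)
  rw [Real.sinh_sub] at this
  linarith

/-- Monotone form: for `0 ≤ z₀ ≤ z`, `z₀/(1 + z₀) ≤ tanh z`. [folklore] -/
theorem div_one_add_le_tanh_of_le {z₀ z : ℝ} (hz₀ : 0 ≤ z₀) (hz : z₀ ≤ z) :
    z₀ / (1 + z₀) ≤ Real.tanh z :=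
  (div_one_add_le_tanh hz₀).trans (tanh_le_tanh' hz)

/-- **Rate floor**: for `k₀ ≥ 0` and `0 ≤ ℓ₀ ≤ ℓ`, `k₀²ℓ₀/(1 + k₀ℓ₀) ≤ k₀·tanh(k₀ℓ)`. [folklore] -/
theorem sq_mul_div_one_add_le_mul_tanh {k₀ ℓ₀ ℓ : ℝ} (hk₀ : 0 ≤ k₀) (hℓ₀ : 0 ≤ ℓ₀) (hℓ : ℓ₀ ≤ ℓ) :
    k₀ ^ 2 * ℓ₀ / (1 + k₀ * ℓ₀) ≤ k₀ * Real.tanh (k₀ * ℓ) := by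
  have hz₀ : 0 ≤ k₀ * ℓ₀ := mul_nonneg hk₀ hℓ₀
  have h := div_one_add_le_tanh_of_le hz₀ (mul_le_mul_of_nonneg_left hℓ hk₀)
  have e : k₀ ^ 2 * ℓ₀ / (1 + k₀ * ℓ₀) = k₀ * (k₀ * ℓ₀ / (1 + k₀ * ℓ₀)) := by ring
  rw [e]
  exact mul_le_mul_of_nonneg_left h hk₀

/-! ### Depth from an interior sub-barrier -/

/-- **Growth of the recessive branch certified on an interior stretch.** Let `d″ = q d` on `[α, β]`
(pointwise `HasDerivAt` data) with `q ≥ 0`, `d ≥ 0` on `[α, β]` and `d′(β) ≤ 0`, and let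
`[s₀, s₁] ⊆ [α, β]` be a stretch on which `q ≥ k²` (`k > 0`). Then
`d(s₁)·cosh(k(s₁ − s₀)) ≤ d(α)` and `d(s₁)·k·sinh(k(s₁ − s₀)) ≤ −d′(α)`: on the stretch,
`d(s₀) ≥ d(s₁) cosh` (`mul_cosh_le_of_sq_le_coeff_left`) and `−d′(s₀) ≥ k tanh · d(s₀)`
(`tanh_mul_le_neg_deriv`); below it, `d` is non-increasing and `d′` non-decreasing.
[cite: Hartman2002, Ch. XI Thm. 3.2 and Ex. 3.1(a)] -/
theorem cosh_mul_le_and_sinh_mul_le_of_subBarrier {d d' q : ℝ → ℝ} {α β s₀ s₁ k : ℝ}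
    (hd : ∀ s ∈ Icc α β, HasDerivAt d (d' s) s ∧ HasDerivAt d' (q s * d s) s)
    (hq0 : ∀ s ∈ Icc α β, 0 ≤ q s) (hd0 : ∀ s ∈ Icc α β, 0 ≤ d s) (hdβ : d' β ≤ 0)
    (hαs₀ : α ≤ s₀) (hs₀₁ : s₀ ≤ s₁) (hs₁β : s₁ ≤ β) (hk : 0 < k)
    (hqk : ∀ s ∈ Icc s₀ s₁, k ^ 2 ≤ q s) :
    d s₁ * Real.cosh (k * (s₁ - s₀)) ≤ d α ∧ d s₁ * (k * Real.sinh (k * (s₁ - s₀))) ≤ -d' α := by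
  have hαβ : α ≤ β := hαs₀.trans (hs₀₁.trans hs₁β)
  have hsub : Icc s₀ s₁ ⊆ Icc α β := Icc_subset_Icc hαs₀ hs₁β
  -- `d′` is non-decreasing on `[α, β]`, hence `d′ ≤ 0` there and `d` is non-increasing
  have hmono := deriv_monotoneOn_of_nonneg hd hq0 hd0
  have hd'le : ∀ s ∈ Icc α β, d' s ≤ 0 := fun s hs ↦
    (hmono hs (right_mem_Icc.2 hαβ) hs.2).trans hdβ
  have hanti : AntitoneOn d (Icc α β) :=
    antitoneOn_of_deriv_nonpos (convex_Icc α β)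
      (fun s hs ↦ (hd s hs).1.continuousAt.continuousWithinAt)
      (fun s hs ↦ (hd s (interior_subset hs)).1.differentiableAt.differentiableWithinAt)
      fun s hs ↦ by
        have hs' : s ∈ Icc α β := interior_subset hs
        rw [(hd s hs').1.deriv]; exact hd'le s hs'
  have hs₀ : s₀ ∈ Icc α β := ⟨hαs₀, hs₀₁.trans hs₁β⟩
  have hs₁ : s₁ ∈ Icc α β := ⟨hαs₀.trans hs₀₁, hs₁β⟩
  have hα : α ∈ Icc α β := left_mem_Icc.2 hαβ
  -- on the stretch
  have hcosh : d s₁ * Real.cosh (k * (s₁ - s₀)) ≤ d s₀ :=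
    mul_cosh_le_of_sq_le_coeff_left (fun s hs ↦ hd s (hsub hs)) hqk
      (fun s hs ↦ hd0 s (hsub hs)) (hd'le s₁ hs₁) s₀ (left_mem_Icc.2 hs₀₁)
  have hrate : k * Real.tanh (k * (s₁ - s₀)) * d s₀ ≤ -d' s₀ :=
    tanh_mul_le_neg_deriv (fun s hs ↦ hd s (hsub hs)) hqk (fun s hs ↦ hd0 s (hsub hs))
      (hd'le s₁ hs₁) s₀ (left_mem_Icc.2 hs₀₁)
  -- down to `α`
  have h1 : d s₀ ≤ d α := hanti hα hs₀ hαs₀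
  have h2 : -d' s₀ ≤ -d' α := neg_le_neg (hmono hα hs₀ hαs₀)
  refine ⟨hcosh.trans h1, le_trans ?_ (hrate.trans h2)⟩
  -- `d(s₁)·k sinh = k tanh · (d(s₁) cosh) ≤ k tanh · d(s₀)`
  have hkℓ : 0 ≤ k * (s₁ - s₀) := mul_nonneg hk.le (sub_nonneg.2 hs₀₁)
  have htanh0 : 0 ≤ k * Real.tanh (k * (s₁ - s₀)) := by
    rw [Real.tanh_eq_sinh_div_cosh]
    exact mul_nonneg hk.le (div_nonneg (Real.sinh_nonneg_iff.2 hkℓ) (Real.cosh_pos _).le)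
  have e : d s₁ * (k * Real.sinh (k * (s₁ - s₀))) =
      k * Real.tanh (k * (s₁ - s₀)) * (d s₁ * Real.cosh (k * (s₁ - s₀))) := by
    rw [Real.tanh_eq_sinh_div_cosh]
    field_simp
  rw [e]
  exact mul_le_mul_of_nonneg_left hcosh htanh0

/-! ### The packaged dominance statement and the kernel bound -/

/-- **Recessive dominance, depth from an interior sub-barrier.** Let `q` be continuous with
`q ≥ k₀²` on `[α, β]` (`k₀ ≥ 0`) and `q ≥ k²` on a stretch `[s₀, s₁] ⊆ [α, β]` (`s₀ < s₁`, `k > 0`),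
and let `v` be a complex solution of `y″ = q y` on `[α, β]` with `‖v′(β)‖ ≤ P₁` and flux
`Im(v̄(β) v′(β)) = F`. If `8P₁² ≤ k|F|·sinh(2k(s₁ − s₀))`, then
`Re(v̄(α) v′(α)) ≤ −(7/25)·k₀ tanh(k₀(β − α))·|v(α)|²` (barrier basis of `exists_barrierBasis`;
depth `d(α)(−d′(α)) ≥ cosh·k sinh = (k/2) sinh(2k(s₁ − s₀))` by
`cosh_mul_le_and_sinh_mul_le_of_subBarrier`; rate by `tanh_mul_le_neg_deriv` with the global floor).
[folklore] -/
theorem re_conj_mul_deriv_le_of_right_flux_subBarrier {q : ℝ → ℝ} (hq : Continuous q)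
    {α β s₀ s₁ k k₀ : ℝ} (hαs₀ : α ≤ s₀) (hs₀₁ : s₀ < s₁) (hs₁β : s₁ ≤ β) (hk : 0 < k)
    (hk₀ : 0 ≤ k₀) (hqk₀ : ∀ x ∈ Icc α β, k₀ ^ 2 ≤ q x) (hqk : ∀ x ∈ Icc s₀ s₁, k ^ 2 ≤ q x)
    {v v' : ℝ → ℂ} (hv : ∀ x ∈ Icc α β, HasDerivAt v (v' x) x ∧ HasDerivAt v' ((q x : ℂ) * v x) x)
    {F P₁ : ℝ} (hF : (conj (v β) * v' β).im = F) (hP₁ : ‖v' β‖ ≤ P₁)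
    (hdeep : 8 * P₁ ^ 2 ≤ k * |F| * Real.sinh (2 * (k * (s₁ - s₀)))) :
    (conj (v α) * v' α).re ≤ -(7 / 25 * (k₀ * Real.tanh (k₀ * (β - α)))) * ‖v α‖ ^ 2 := by
  have hαβ : α ≤ β := hαs₀.trans (hs₀₁.le.trans hs₁β)
  have hq0 : ∀ x ∈ Icc α β, 0 ≤ q x := fun x hx ↦ (sq_nonneg k₀).trans (hqk₀ x hx)
  obtain ⟨g, g', d, d', hg, hd, hgα, hg'α, hdβ, hd'β, hsign, -, -, hW, hd'α, -⟩ :=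
    exists_barrierBasis hq hαβ hq0
  have hα : α ∈ Icc α β := left_mem_Icc.2 hαβ
  have hs₁ : s₁ ∈ Icc α β := ⟨hαs₀.trans hs₀₁.le, hs₁β⟩
  set w₀ := g' β with hw₀def
  set ℓ := s₁ - s₀ with hℓ
  have hℓ0 : 0 < ℓ := sub_pos.2 hs₀₁
  have hkℓ : 0 < k * ℓ := mul_pos hk hℓ0
  -- growth on the stretch, transported to `α`
  obtain ⟨hdcosh, hdsinh⟩ := cosh_mul_le_and_sinh_mul_le_of_subBarrier (fun s _ ↦ hd s) hq0
    (fun s hs ↦ by linarith [(hsign s hs).2.2.1]) hd'β.le hαs₀ hs₀₁.le hs₁β hk hqk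
  have hd₁ : 1 ≤ d s₁ := (hsign s₁ hs₁).2.2.1
  have hcoshα : Real.cosh (k * ℓ) ≤ d α :=
    (le_mul_of_one_le_left (Real.cosh_pos _).le hd₁).trans hdcosh
  have hks0 : 0 < k * Real.sinh (k * ℓ) := mul_pos hk (Real.sinh_pos_iff.2 hkℓ)
  have hsinhα : k * Real.sinh (k * ℓ) ≤ -d' α :=
    (le_mul_of_one_le_left hks0.le hd₁).trans hdsinh
  -- `w₀ = −d′(α) > 0`
  have hw₀eq : w₀ = -d' α := by rw [hd'α]; ring
  have hw₀ : 0 < w₀ := by rw [hw₀eq]; exact hks0.trans_le hsinhα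
  -- depth `d(α) w₀ ≥ cosh(kℓ)·k sinh(kℓ) = (k/2) sinh(2kℓ)`
  have hdepth : 4 * P₁ ^ 2 ≤ |F| * (d α * w₀) := by
    have h1 : Real.cosh (k * ℓ) * (k * Real.sinh (k * ℓ)) ≤ d α * w₀ := by
      rw [hw₀eq]
      exact mul_le_mul hcoshα hsinhα hks0.le (by linarith [(hsign α hα).2.2.1])
    have h2 : Real.cosh (k * ℓ) * (k * Real.sinh (k * ℓ)) = k / 2 * Real.sinh (2 * (k * ℓ)) := by
      rw [Real.sinh_two_mul]; ring
    rw [h2] at h1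
    have h3 : |F| * (k / 2 * Real.sinh (2 * (k * ℓ))) ≤ |F| * (d α * w₀) :=
      mul_le_mul_of_nonneg_left h1 (abs_nonneg F)
    nlinarith [h3, hdeep, abs_nonneg F]
  -- rate at `α` with the global floor
  have hrate : k₀ * Real.tanh (k₀ * (β - α)) * d α ≤ -d' α :=
    tanh_mul_le_neg_deriv (fun s hs ↦ hd s) hqk₀ (fun s hs ↦ by linarith [(hsign s hs).2.2.1])
      hd'β.le α hα
  have hr0 : 0 ≤ k₀ * Real.tanh (k₀ * (β - α)) := by
    rw [Real.tanh_eq_sinh_div_cosh]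
    exact mul_nonneg hk₀ (div_nonneg (Real.sinh_nonneg_iff.2
      (mul_nonneg hk₀ (sub_nonneg.2 hαβ))) (Real.cosh_pos _).le)
  have hWg : ∀ x ∈ Icc α β, g x * d' x - g' x * d x = -w₀ := fun x hx ↦ by
    have := hW x hx; rw [hw₀def]; linarith [this]
  exact re_conj_mul_deriv_le_of_right_flux hαβ hw₀ (fun x _ ↦ hg x) (fun x _ ↦ hd x) hgα hg'α
    hdβ hd'β rfl hWg (by linarith [(hsign α hα).2.2.1]) hv hF hP₁ hr0 hrate hdepth

/-- **Two-point Green kernel deep inside a barrier, quasi-monotone partner.** If at `α` the solution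
`v` is inward-growing at rate `r ≥ 0` (`Re(v̄ v′)(α) ≤ −r|v(α)|²`), `u` is outward-growing there
(`Re(ū u′)(α) ≥ 0`) and `|u(x)| ≤ A|u(α)|` (`A ≥ 0`), then `r·|u(x)||v(α)| ≤ A·|u(α) v′(α) − v(α) u′(α)|`
(`two_point_le_norm_wronskian_of_rates` with `k₁ = 0`). [folklore] -/
theorem kernel_le_of_recessive_dominated_quasi {u u' v v' : ℝ → ℂ} {x α r A : ℝ} (hA : 0 ≤ A)
    (hr : 0 ≤ r) (hmono : ‖u x‖ ≤ A * ‖u α‖) (hu : 0 ≤ (conj (u α) * u' α).re)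
    (hv : (conj (v α) * v' α).re ≤ -r * ‖v α‖ ^ 2) :
    r * (‖u x‖ * ‖v α‖) ≤ A * ‖u α * v' α - v α * u' α‖ := by
  have h := two_point_le_norm_wronskian_of_rates (k₁ := 0) (k₂ := r) hA hr hmono
    (by rw [neg_zero, zero_mul]; exact hu) hv
  rwa [sub_zero] at h

end Literature.Analysis.ODE

end
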